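import Summits.BirchSwinnertonDyer.BirchSwinnertonDyer.Theorems.GoldfeldAllTwistsTwoConverseTwinAdditiveTwoSplitThreeTwistSelmer
import Summits.BirchSwinnertonDyer.BirchSwinnertonDyer.Theorems.GoldfeldK12AdditiveTwoDescentFamiliesCorank
import HarnessLib

set_option linter.dupNamespace false -- namespace `…BirchSwinnertonDyer.BirchSwinnertonDyer…` is the cell's (D-0017 nested layout)
set_option autoImplicit false

/-!
# Twin″ (item 19140), XX: `rank ≤ 1`, `Ш[2] = 0` in rank one, `corank₂ = 1`, and `BSD(W,2)` as a `2`-adic unit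
# statement for `49a1^{(−2ℓ)}`, `ℓ ≡ 3 (mod 8)` prime SPLIT in `ℚ(√−7)`

Cell `bsd-goldfeld`, seat `bsd-goldfeld-s1p-c301` (gen 3); `--supports stmt-BirchSwinnertonDyer-19140`. From part XIX
(`#S(−42ℓ,448ℓ²) ≤ 4`, `#S(84ℓ,−28ℓ²) ≤ 2`) and the cell's counting / transport / corank lemmas (parts VII,
`…TwinAdditiveDescentCorank`, `GoldfeldK12AdditiveTwoDescentFamiliesCorank`): for every model `W/ℚ` of `49a1^{(−2ℓ)}`
(`C • W = cm7.quadraticTwist (−2ℓ)`), `ℓ ≡ 3 (mod 8)` prime, `(−7/ℓ) = +1` (family `𝒱' = {−22, −86, −134, −214, −262, …}`):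

* `rank W(ℚ) ≤ 1` UNCONDITIONALLY and `rank W(ℚ) = 1 ⇒ Ш(W/ℚ)[2] = 0` (`rank_le_one_and_sha_two_twoSplitThreeTwist`);
* `corank_{ℤ₂} Sel_{2^∞}(W/ℚ) = 1` granted only Modularity, CLTZ Thm. 1.2 at `R = 1` and `2`-parity
  (`selmerCorank_two_eq_one_twoSplitThreeTwist`) — the hypothesis of K12₂″ is automatic on `𝒱'`;
* in analytic rank one, granted GZK: `rank = 1`, `Ш(W)[2^∞] = 0` and
  **`BSD(W,2) ⟺ ∃ q : ℚ, #Ш_an(W) = q ∧ ord₂ q = 0`** (`bsdp_two_iff_shaAn_unit_twoSplitThreeTwist`).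

Coverage of the additive prime twists after parts I–XX: `49a1^{(−ℓ)}` for all primes `ℓ ≡ 5 (mod 8)` and all inert
`ℓ ≡ 1 (mod 8)`; `49a1^{(−2ℓ)}` for ALL primes `ℓ` except the split `ℓ ≡ 1 (mod 8)` (where `Ш[2] ≅ (ℤ/2)²` occurs).
HONEST FRAMING: no `BSD(W,2)` is proved; BSD is not proved by any of this.

References: Silverman, *AEC* (2009), X.4.2(a), X.4.9 [SilvermanAEC2009]; Miller, LMS JCM 14 (2011), Def. 1.1
[Miller2011LMS]; Dokchitser–Dokchitser, Ann. of Math. 172 (2010) Thm. 1.4 [DokchitserDokchitserAnnals2010].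
-/

noncomputable section

open scoped Classical

open WeierstrassCurve Literature.NumberTheory.EllipticCurves Literature.NumberTheory.EllipticCurves.ModularForms

namespace Summit.BirchSwinnertonDyer.BirchSwinnertonDyer.Theorems.GoldfeldGoodTwists

/-- **`rank E_{−2ℓ}(ℚ) ≤ 1`, and `rank = 1 ⇒ Ш(E_{−2ℓ}/ℚ)[2] = 0`** (UNCONDITIONAL) for the two-torsion model
`E_{−2ℓ} : y² = x³ − 42ℓx² + 448ℓ²x`, `ℓ ≡ 3 (mod 8)` prime with `(−7/ℓ) = 1` (`#S · #S' ≤ 8`).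
[cite: SilvermanAEC2009, Thm. X.4.2(a), Prop. X.4.9] -/
theorem rank_le_one_and_sha_two_twoTorsionModel_twoSplitThreeTwist {l : ℕ} [Fact l.Prime]
    (hl8 : l % 8 = 3) (hl7 : legendreSym l (-7) = 1)
    [hE : (⟨0, ((-42 * l : ℤ) : ℚ), 0, ((448 * l ^ 2 : ℤ) : ℚ), 0⟩ : WeierstrassCurve ℚ).IsElliptic] :
    (⟨0, ((-42 * l : ℤ) : ℚ), 0, ((448 * l ^ 2 : ℤ) : ℚ), 0⟩ : WeierstrassCurve ℚ).mordellWeilRank ≤ 1 ∧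
      ((⟨0, ((-42 * l : ℤ) : ℚ), 0, ((448 * l ^ 2 : ℤ) : ℚ), 0⟩ : WeierstrassCurve ℚ).mordellWeilRank = 1 →
        ∀ c ∈ (⟨0, ((-42 * l : ℤ) : ℚ), 0, ((448 * l ^ 2 : ℤ) : ℚ), 0⟩ : WeierstrassCurve ℚ).sha,
          2 • c = 0 → c = 0) := by
  have hl : l.Prime := Fact.out
  have hab := hab_inertTwoTwist hl.pos
  haveI := isElliptic_halfModel hab
  have hS := card_twoIsogenySelmerGroup_twoSplitThreeTwist_le hl8
  have hS' := card_twoIsogenySelmerGroup'_twoSplitThreeTwist_le hl8 hl7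
  obtain ⟨hr, hparts⟩ := rank_le_one_and_sha_parts_of_card_mul_le hab
    (by nlinarith [hS, hS', Nat.zero_le (twoIsogenySelmerGroup (-42 * l) (448 * l ^ 2)).card])
  refine ⟨hr, fun h => ?_⟩
  obtain ⟨h₀, h₁⟩ := hparts h
  exact forall_mem_sha_two_smul_eq_zero_of_halfModel h₀ h₁

/-- **UNCONDITIONAL: `rank W(ℚ) ≤ 1`, and `rank W(ℚ) = 1 ⇒ Ш(W/ℚ)[2] = 0`, for every model `W` of
`49a1^{(−2ℓ)}`**, `ℓ ≡ 3 (mod 8)` prime with `(−7/ℓ) = 1`.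
[cite: SilvermanAEC2009, Thm. X.4.2(a), Prop. X.4.9, Thm. III.6.2(a)] -/
theorem rank_le_one_and_sha_two_twoSplitThreeTwist {l : ℕ} [Fact l.Prime] (hl8 : l % 8 = 3)
    (hl7 : legendreSym l (-7) = 1) (W : WeierstrassCurve ℚ) [W.IsElliptic] (C : VariableChange ℚ)
    (hC : C • W = cm7.quadraticTwist ((-2 * l : ℤ) : ℚ)) :
    W.mordellWeilRank ≤ 1 ∧ (W.mordellWeilRank = 1 → ∀ c ∈ W.sha, 2 • c = 0 → c = 0) := by
  have hl : l.Prime := Fact.out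
  haveI := isElliptic_mk_of_ne_zero (F := ℚ) (hab_inertTwoTwist hl.pos)
  have hE := (smul_eq_twoTorsionModel_of_smul_eq_quadraticTwist (-2 * l) W C hC).trans
    (show (⟨0, ((21 * (-2 * l : ℤ) : ℤ) : ℚ), 0, ((112 * (-2 * l : ℤ) ^ 2 : ℤ) : ℚ), 0⟩ :
        WeierstrassCurve ℚ) = ⟨0, ((-42 * l : ℤ) : ℚ), 0, ((448 * l ^ 2 : ℤ) : ℚ), 0⟩ by
      ext <;> push_cast <;> ring)
  exact rank_le_one_and_sha_two_of_smul_eq W _ _ hE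
    (rank_le_one_and_sha_two_twoTorsionModel_twoSplitThreeTwist hl8 hl7)

/-- **`corank_{ℤ₂} Sel_{2^∞}(W/ℚ) = 1` on `𝒱' = {49a1^{(−2ℓ)} : ℓ ≡ 3 (mod 8) split}`**, every model, granted Modularity
(`hnf`), CLTZ Thm. 1.2 at `R = 1` (`h12`) and `2`-parity (`hpar`): `≤ 1` by the descent, odd by the sign.
[cite: DokchitserDokchitserAnnals2010, Thm. 1.4] [cite: SilvermanAEC2009, Thm. X.4.2(a), Prop. X.4.9] -/
theorem selmerCorank_two_eq_one_twoSplitThreeTwist (hnf : exists_isNewformOf)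
    (h12 : CoatesLiTianZhai2015.thm12_fullBSD_twist) (hpar : ∀ (V : WeierstrassCurve ℚ) [V.IsElliptic], p_parity V 2)
    {l : ℕ} [Fact l.Prime] (hl8 : l % 8 = 3) (hl7 : legendreSym l (-7) = 1)
    (W : WeierstrassCurve ℚ) [W.IsElliptic] (C : VariableChange ℚ)
    (hC : C • W = cm7.quadraticTwist ((-2 * l : ℤ) : ℚ)) : W.selmerCorank 2 = 1 := by
  obtain ⟨hsq, h7, hd, hE⟩ := twoPrimeTwist_data (by rintro rfl; norm_num at hl8) (by rw [hl7]; decide) W C hC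
  have hS := card_twoIsogenySelmerGroup_twoSplitThreeTwist_le hl8
  have hS' := card_twoIsogenySelmerGroup'_twoSplitThreeTwist_le hl8 hl7
  exact selmerCorank_two_eq_one_of_smul_eq_of_card_mul_le hnf h12 hpar hsq h7 hd W C hC
    (hab_inertTwoTwist (Fact.out : l.Prime).pos) _ hE (by nlinarith)

/-- **Twin″ on `49a1^{(−2ℓ)}`, `ℓ ≡ 3 (mod 8)` prime split in `ℚ(√−7)`**: for every model `W` of analytic
rank `1`, granted GZK: `rank = 1`, `Ш(W)[2^∞] = 0`, `corank_{ℤ₂} Sel_{2^∞}(W) = 1`, and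
**`BSD(W,2) ⟺ ∃ q : ℚ, #Ш_an(W) = q ∧ ord₂ q = 0`**. [cite: Miller2011LMS, Def. 1.1] [cite: SilvermanAEC2009, Thm. X.4.2(a)] -/
theorem bsdp_two_iff_shaAn_unit_twoSplitThreeTwist (hGZK : rank_eq_analyticRank_of_analyticRank_le_one)
    {l : ℕ} [Fact l.Prime] (hl8 : l % 8 = 3) (hl7 : legendreSym l (-7) = 1)
    (W : WeierstrassCurve ℚ) [W.IsElliptic] (C : VariableChange ℚ)
    (hC : C • W = cm7.quadraticTwist ((-2 * l : ℤ) : ℚ)) (har : W.analyticRank = 1) :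
    W.mordellWeilRank = 1 ∧ AddCommGroup.primaryComponent W.sha 2 = ⊥ ∧ W.selmerCorank 2 = 1 ∧
      (BSDp W 2 ↔ ∃ q : ℚ, shaAn W = (q : ℂ) ∧ padicValRat 2 q = 0) := by
  haveI : Fact (Nat.Prime 2) := ⟨Nat.prime_two⟩
  have hrank : W.mordellWeilRank = W.analyticRank := (hGZK W (by rw [har])).1
  have hr : W.mordellWeilRank = 1 := by rw [hrank, har]
  have h2 := (rank_le_one_and_sha_two_twoSplitThreeTwist hl8 hl7 W C hC).2 hr
  obtain ⟨hbot, hiff⟩ := bsdp_two_iff_shaAn_unit_of_forall_mem_sha W h2 hrank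
  refine ⟨hr, hbot, ?_, hiff⟩
  rw [W.selmerCorank_eq_mordellWeilRank_add_holds 2, hr, W.shaCorank_eq_zero_of_forall 2 h2]

end Summit.BirchSwinnertonDyer.BirchSwinnertonDyer.Theorems.GoldfeldGoodTwists

end
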